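import Literature.Analysis.SpecialFunctions.SelbergLimit
import Literature.Analysis.SpecialFunctions.SelbergAnalyticLemmas
import Mathlib.Probability.Moments.Basic
import Mathlib.Analysis.SpecialFunctions.Gamma.Beta
import Mathlib.Analysis.SpecialFunctions.Gamma.Deriv
import HarnessLib

/-!
# The Selberg integral as a Laplace transform in each parameter

For the analytic-continuation and log-convexity steps of the proof of Selberg's formula
(`Literature.Analysis.SpecialFunctions.selberg_integral_formula`; Aomoto's route, G. E. Andrews,
R. Askey, R. Roy, *Special Functions* (1999), §8.2, and the continuation to the full domain
(1.2) of P. J. Forrester, S. O. Warnaar, Bull. AMS 45 (2008)) we write the Selberg integral as a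
moment generating function `∫ e^{sX} dμ` of a nonpositive function `X` under a finite measure
`μ` on the cube, separately in each of the three parameters:

* in `a`: `X = ∑ᵢ log tᵢ`, `dμ = ∏ᵢ (1-tᵢ)^{b-1} ∏_{i<j}|tᵢ-tⱼ|^{2c} dt`, `s = a - 1`;
* in `b`: `X = ∑ᵢ log (1-tᵢ)`, `dμ = ∏ᵢ tᵢ^{a-1} ∏_{i<j}|tᵢ-tⱼ|^{2c} dt`, `s = b - 1`;
* in `c`: `X = ∑_{i<j} 2 log |tᵢ-tⱼ|`, `dμ = ∏ᵢ tᵢ^{a-1}(1-tᵢ)^{b-1} dt`, `s = c`.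

Consequences proved here: strict positivity of the Selberg integral, and log-convexity in `a` of
both `selbergIntegral` (Hölder) and `selbergProduct` (via `Γ(x)/Γ(x+d) = B(x,d)/Γ(d)`, i.e. the
`n = 1` case of the former). Also here: the complexified Selberg product `selbergProductC` and its
holomorphy on half-planes where all Gamma arguments have positive real part (the analytic input
of the Landau continuation).

Everything here is fully proved; no named facts.
-/

noncomputable section

open MeasureTheory ProbabilityTheory Real Finset Set Filter Topology

open scoped NNReal ENNReal

namespace Literature.Analysis.SpecialFunctions

namespace Selberg

/-! ### Tilted measures on the cube -/

/-- Lebesgue measure on the cube tilted by a (nonnegative) density `D`. [folklore] -/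
def cubeMeasure (n : ℕ) (D : (Fin n → ℝ) → ℝ) : Measure (Fin n → ℝ) :=
  (volume.restrict (cube n)).withDensity fun t => ((D t).toNNReal : ℝ≥0∞)

/-- The mgf under the tilted measure is a weighted integral over the cube. [folklore] -/
theorem mgf_cubeMeasure {n : ℕ} {D : (Fin n → ℝ) → ℝ} (hD : Measurable D)
    (hD0 : ∀ t ∈ cube n, 0 ≤ D t) (X : (Fin n → ℝ) → ℝ) (s : ℝ) :
    mgf X (cubeMeasure n D) s = ∫ t in cube n, D t * exp (s * X t) := by
  rw [mgf, cubeMeasure, integral_withDensity_eq_integral_smul hD.real_toNNReal]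
  refine setIntegral_congr_fun (measurableSet_cube n) fun t ht => ?_
  simp only [NNReal.smul_def, smul_eq_mul, Real.coe_toNNReal _ (hD0 t ht)]

/-- Integrability under the tilted measure. [folklore] -/
theorem integrable_cubeMeasure_iff {n : ℕ} {D : (Fin n → ℝ) → ℝ} (hD : Measurable D)
    (hD0 : ∀ t ∈ cube n, 0 ≤ D t) (g : (Fin n → ℝ) → ℝ) :
    Integrable g (cubeMeasure n D) ↔ IntegrableOn (fun t => D t * g t) (cube n) := by
  rw [cubeMeasure, integrable_withDensity_iff_integrable_smul hD.real_toNNReal, IntegrableOn]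
  refine integrable_congr ?_
  filter_upwards [ae_restrict_mem (measurableSet_cube n)] with t ht
  simp only [NNReal.smul_def, smul_eq_mul, Real.coe_toNNReal _ (hD0 t ht)]

/-- Almost-everywhere statements transfer to the tilted measure. [folklore] -/
theorem ae_cubeMeasure {n : ℕ} {D : (Fin n → ℝ) → ℝ} (hD : Measurable D) {p : (Fin n → ℝ) → Prop}
    (h : ∀ᵐ t ∂(volume.restrict (cube n)), p t) : ∀ᵐ t ∂(cubeMeasure n D), p t := by
  rw [cubeMeasure, ae_withDensity_iff hD.real_toNNReal.coe_nnreal_ennreal]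
  exact h.mono fun t ht _ => ht

/-- Almost every point of the cube has all coordinates in `(0,1)` and pairwise distinct.
[folklore] -/
theorem ae_cube_good (n : ℕ) : ∀ᵐ t ∂(volume.restrict (cube n)),
    (∀ i, 0 < t i ∧ t i < 1) ∧ Function.Injective t := by
  have h0 : ∀ᵐ t : Fin n → ℝ, ∀ i, t i ≠ 0 := by
    rw [ae_all_iff]; intro i
    exact Measure.ae_eval_ne (fun _ : Fin n => (volume : Measure ℝ)) i 0
  have h1 : ∀ᵐ t : Fin n → ℝ, ∀ i, t i ≠ 1 := by
    rw [ae_all_iff]; intro i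
    exact Measure.ae_eval_ne (fun _ : Fin n => (volume : Measure ℝ)) i 1
  filter_upwards [ae_restrict_of_ae h0, ae_restrict_of_ae h1, ae_restrict_of_ae (ae_injective n),
    ae_restrict_mem (measurableSet_cube n)] with t ht0 ht1 hinj hmem
  rw [mem_cube_iff] at hmem
  exact ⟨fun i => ⟨lt_of_le_of_ne (hmem i).1 (ht0 i).symm, lt_of_le_of_ne (hmem i).2 (ht1 i)⟩,
    hinj⟩

/-! ### The representation in `a` -/

/-- Density for the `a`-representation: `∏ᵢ (1-tᵢ)^{b-1} ∏_{i<j} |tᵢ-tⱼ|^{2c}`. [folklore] -/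
def densA (n : ℕ) (b c : ℝ) (t : Fin n → ℝ) : ℝ := (∏ i, (1 - t i) ^ (b - 1)) * pairLT n c t

/-- Exponent for the `a`-representation: `∑ᵢ log tᵢ`. [folklore] -/
def XA (n : ℕ) (t : Fin n → ℝ) : ℝ := ∑ i, Real.log (t i)

/-- `densA` is measurable. [folklore] -/
@[fun_prop]
theorem measurable_densA (n : ℕ) (b c : ℝ) : Measurable (densA n b c) := by
  unfold densA
  refine Measurable.mul (Finset.measurable_prod _ fun i _ => by fun_prop) (measurable_pairLT n c)

/-- `XA` is measurable. [folklore] -/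
@[fun_prop]
theorem measurable_XA (n : ℕ) : Measurable (XA n) := by
  unfold XA
  refine Finset.measurable_sum _ fun i _ => ?_
  exact Real.measurable_log.comp (measurable_pi_apply i)

/-- `densA ≥ 0` on the cube. [folklore] -/
theorem densA_nonneg {n : ℕ} (b c : ℝ) {t : Fin n → ℝ} (ht : t ∈ cube n) : 0 ≤ densA n b c t := by
  rw [mem_cube_iff] at ht
  exact mul_nonneg (prod_nonneg fun i _ => rpow_nonneg (by linarith [(ht i).2]) _)
    (pairLT_nonneg n c t)

/-- On good points, `densA · e^{(a-1) X_A} = W`. [folklore] -/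
theorem densA_mul_exp {n : ℕ} (a b c : ℝ) {t : Fin n → ℝ} (ht : ∀ i, 0 < t i) :
    densA n b c t * exp ((a - 1) * XA n t) = weight n a b c t := by
  rw [XA, Finset.mul_sum, Real.exp_sum, weight, body, densA]
  have : ∀ i, exp ((a - 1) * Real.log (t i)) = t i ^ (a - 1) := fun i => by
    rw [Real.rpow_def_of_pos (ht i), mul_comm]
  simp_rw [this]
  rw [mul_comm (∏ i, (1 - t i) ^ (b - 1)) (pairLT n c t), mul_assoc, ← prod_mul_distrib]
  rw [mul_comm]
  congr 1
  exact prod_congr rfl fun i _ => by ring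

/-- **The Selberg integral is an mgf in `a`.** [folklore] -/
theorem selbergIntegral_eq_mgf_A (n : ℕ) (a b c : ℝ) :
    selbergIntegral n a b c = mgf (XA n) (cubeMeasure n (densA n b c)) (a - 1) := by
  rw [mgf_cubeMeasure (measurable_densA n b c) (fun t ht => densA_nonneg b c ht),
    selbergIntegral_eq_integral_weight]
  refine integral_congr_ae ?_
  filter_upwards [ae_cube_good n] with t ht
  rw [densA_mul_exp a b c fun i => (ht.1 i).1]

/-- Integrability in the `a`-representation. [folklore] -/
theorem integrable_exp_XA_iff {n : ℕ} (b c s : ℝ) :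
    Integrable (fun t => exp (s * XA n t)) (cubeMeasure n (densA n b c)) ↔
      IntegrableOn (weight n (s + 1) b c) (cube n) := by
  rw [integrable_cubeMeasure_iff (measurable_densA n b c) (fun t ht => densA_nonneg b c ht)]
  refine integrable_congr ?_
  filter_upwards [ae_cube_good n] with t ht
  rw [← densA_mul_exp (s + 1) b c fun i => (ht.1 i).1, add_sub_cancel_right]

/-- `X_A ≤ 0` almost everywhere. [folklore] -/
theorem XA_nonpos (n : ℕ) (b c : ℝ) : ∀ᵐ t ∂(cubeMeasure n (densA n b c)), XA n t ≤ 0 := by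
  refine ae_cubeMeasure (measurable_densA n b c) ?_
  filter_upwards [ae_restrict_mem (measurableSet_cube n)] with t ht
  rw [mem_cube_iff] at ht
  exact Finset.sum_nonpos fun i _ => Real.log_nonpos (ht i).1 (ht i).2

/-! ### The representation in `b` -/

/-- Density for the `b`-representation: `∏ᵢ tᵢ^{a-1} ∏_{i<j} |tᵢ-tⱼ|^{2c}`. [folklore] -/
def densB (n : ℕ) (a c : ℝ) (t : Fin n → ℝ) : ℝ := (∏ i, t i ^ (a - 1)) * pairLT n c t

/-- Exponent for the `b`-representation: `∑ᵢ log (1 - tᵢ)`. [folklore] -/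
def XB (n : ℕ) (t : Fin n → ℝ) : ℝ := ∑ i, Real.log (1 - t i)

/-- `densB` is measurable. [folklore] -/
@[fun_prop]
theorem measurable_densB (n : ℕ) (a c : ℝ) : Measurable (densB n a c) := by
  unfold densB
  refine Measurable.mul (Finset.measurable_prod _ fun i _ => by fun_prop) (measurable_pairLT n c)

/-- `XB` is measurable. [folklore] -/
@[fun_prop]
theorem measurable_XB (n : ℕ) : Measurable (XB n) := by
  unfold XB
  refine Finset.measurable_sum _ fun i _ => ?_
  exact Real.measurable_log.comp (measurable_const.sub (measurable_pi_apply i))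

/-- `densB ≥ 0` on the cube. [folklore] -/
theorem densB_nonneg {n : ℕ} (a c : ℝ) {t : Fin n → ℝ} (ht : t ∈ cube n) : 0 ≤ densB n a c t := by
  rw [mem_cube_iff] at ht
  exact mul_nonneg (prod_nonneg fun i _ => rpow_nonneg (ht i).1 _) (pairLT_nonneg n c t)

/-- On good points, `densB · e^{(b-1) X_B} = W`. [folklore] -/
theorem densB_mul_exp {n : ℕ} (a b c : ℝ) {t : Fin n → ℝ} (ht : ∀ i, t i < 1) :
    densB n a c t * exp ((b - 1) * XB n t) = weight n a b c t := by
  rw [XB, Finset.mul_sum, Real.exp_sum, weight, body, densB]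
  have : ∀ i, exp ((b - 1) * Real.log (1 - t i)) = (1 - t i) ^ (b - 1) := fun i => by
    rw [Real.rpow_def_of_pos (by linarith [ht i]), mul_comm]
  simp_rw [this]
  rw [mul_comm (∏ i, t i ^ (a - 1)) (pairLT n c t), mul_assoc, ← prod_mul_distrib, mul_comm]

/-- **The Selberg integral is an mgf in `b`.** [folklore] -/
theorem selbergIntegral_eq_mgf_B (n : ℕ) (a b c : ℝ) :
    selbergIntegral n a b c = mgf (XB n) (cubeMeasure n (densB n a c)) (b - 1) := by
  rw [mgf_cubeMeasure (measurable_densB n a c) (fun t ht => densB_nonneg a c ht),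
    selbergIntegral_eq_integral_weight]
  refine integral_congr_ae ?_
  filter_upwards [ae_cube_good n] with t ht
  rw [densB_mul_exp a b c fun i => (ht.1 i).2]

/-- Integrability in the `b`-representation. [folklore] -/
theorem integrable_exp_XB_iff {n : ℕ} (a c s : ℝ) :
    Integrable (fun t => exp (s * XB n t)) (cubeMeasure n (densB n a c)) ↔
      IntegrableOn (weight n a (s + 1) c) (cube n) := by
  rw [integrable_cubeMeasure_iff (measurable_densB n a c) (fun t ht => densB_nonneg a c ht)]
  refine integrable_congr ?_
  filter_upwards [ae_cube_good n] with t ht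
  rw [← densB_mul_exp a (s + 1) c fun i => (ht.1 i).2, add_sub_cancel_right]

/-- `X_B ≤ 0` almost everywhere. [folklore] -/
theorem XB_nonpos (n : ℕ) (a c : ℝ) : ∀ᵐ t ∂(cubeMeasure n (densB n a c)), XB n t ≤ 0 := by
  refine ae_cubeMeasure (measurable_densB n a c) ?_
  filter_upwards [ae_restrict_mem (measurableSet_cube n)] with t ht
  rw [mem_cube_iff] at ht
  exact Finset.sum_nonpos fun i _ => Real.log_nonpos (by linarith [(ht i).2]) (by linarith [(ht i).1])

/-! ### The representation in `c` -/

/-- Exponent for the `c`-representation: `∑_{i<j} 2 log |tᵢ - tⱼ|`. [folklore] -/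
def XC (n : ℕ) (t : Fin n → ℝ) : ℝ :=
  ∑ i : Fin n, ∑ j ∈ univ.filter (fun j : Fin n => i < j), 2 * Real.log |t i - t j|

/-- `XC` is measurable. [folklore] -/
@[fun_prop]
theorem measurable_XC (n : ℕ) : Measurable (XC n) := by
  unfold XC
  refine Finset.measurable_sum _ fun i _ => Finset.measurable_sum _ fun j _ => ?_
  exact (Real.measurable_log.comp ((measurable_pi_apply i).sub (measurable_pi_apply j)).abs).const_mul 2

/-- On good points, `body · e^{c X_C} = W`. [folklore] -/
theorem body_mul_exp {n : ℕ} (a b c : ℝ) {t : Fin n → ℝ} (ht : Function.Injective t) :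
    body n a b t * exp (c * XC n t) = weight n a b c t := by
  rw [XC, Finset.mul_sum, Real.exp_sum, weight, pairLT]
  congr 1
  refine prod_congr rfl fun i _ => ?_
  rw [Finset.mul_sum, Real.exp_sum]
  refine prod_congr rfl fun j hj => ?_
  rw [Finset.mem_filter] at hj
  have hne : t i - t j ≠ 0 := sub_ne_zero.2 fun h => (ne_of_lt hj.2) (ht h)
  rw [Real.rpow_def_of_pos (abs_pos.2 hne)]
  congr 1
  ring

/-- **The Selberg integral is an mgf in `c`.** [folklore] -/
theorem selbergIntegral_eq_mgf_C (n : ℕ) (a b c : ℝ) :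
    selbergIntegral n a b c = mgf (XC n) (cubeMeasure n (body n a b)) c := by
  rw [mgf_cubeMeasure (measurable_body n a b) (fun t ht => body_nonneg a b ht),
    selbergIntegral_eq_integral_weight]
  refine integral_congr_ae ?_
  filter_upwards [ae_cube_good n] with t ht
  rw [body_mul_exp a b c ht.2]

/-- Integrability in the `c`-representation. [folklore] -/
theorem integrable_exp_XC_iff {n : ℕ} (a b s : ℝ) :
    Integrable (fun t => exp (s * XC n t)) (cubeMeasure n (body n a b)) ↔
      IntegrableOn (weight n a b s) (cube n) := by
  rw [integrable_cubeMeasure_iff (measurable_body n a b) (fun t ht => body_nonneg a b ht)]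
  refine integrable_congr ?_
  filter_upwards [ae_cube_good n] with t ht
  rw [body_mul_exp a b s ht.2]

/-- `X_C ≤ 0` almost everywhere. [folklore] -/
theorem XC_nonpos (n : ℕ) (a b : ℝ) : ∀ᵐ t ∂(cubeMeasure n (body n a b)), XC n t ≤ 0 := by
  refine ae_cubeMeasure (measurable_body n a b) ?_
  filter_upwards [ae_restrict_mem (measurableSet_cube n)] with t ht
  rw [mem_cube_iff] at ht
  refine Finset.sum_nonpos fun i _ => Finset.sum_nonpos fun j _ => ?_
  have h1 : |t i - t j| ≤ 1 := by
    rw [abs_le]; constructor <;> linarith [(ht i).1, (ht i).2, (ht j).1, (ht j).2]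
  have := Real.log_nonpos (abs_nonneg (t i - t j)) h1
  linarith

/-! ### The complexified Selberg product and its holomorphy -/

/-- Selberg's product with complex parameters (complex Gamma functions). [folklore] -/
def selbergProductC (n : ℕ) (a b c : ℂ) : ℂ :=
  ∏ j ∈ range n,
    Complex.Gamma (a + j * c) * Complex.Gamma (b + j * c) * Complex.Gamma (1 + (j + 1) * c) /
      (Complex.Gamma (a + b + ((n : ℂ) + j - 1) * c) * Complex.Gamma (1 + c))

/-- On real parameters the complexified product is the real one. [folklore] -/
theorem selbergProductC_ofReal (n : ℕ) (a b c : ℝ) :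
    selbergProductC n a b c = (selbergProduct n a b c : ℂ) := by
  unfold selbergProductC selbergProduct
  rw [Complex.ofReal_prod]
  refine prod_congr rfl fun j _ => ?_
  push_cast
  simp only [← Complex.Gamma_ofReal]
  push_cast
  ring

/-- Complex Gamma is differentiable at points of positive real part. [folklore] -/
theorem differentiableAt_Gamma_of_re_pos {z : ℂ} (hz : 0 < z.re) :
    DifferentiableAt ℂ Complex.Gamma z := by
  refine Complex.differentiableAt_Gamma z fun m h => ?_
  have := congrArg Complex.re h
  simp at this
  have : (0 : ℝ) ≤ m := by positivity
  linarith

/-- `z ↦ Γ(φ(z))` is holomorphic where `Re φ > 0`. [folklore] -/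
theorem differentiableOn_Gamma_comp {φ : ℂ → ℂ} (hφ : Differentiable ℂ φ) {U : Set ℂ}
    (hU : ∀ z ∈ U, 0 < (φ z).re) : DifferentiableOn ℂ (fun z => Complex.Gamma (φ z)) U :=
  fun z hz => ((differentiableAt_Gamma_of_re_pos (hU z hz)).comp z (hφ z)).differentiableWithinAt

/-- **Holomorphy of the complexified Selberg product** along holomorphic parameter curves, on any
set where all Gamma arguments have positive real part. [folklore] -/
theorem differentiableOn_selbergProductC {n : ℕ} {U : Set ℂ} {A B C : ℂ → ℂ}
    (hA : Differentiable ℂ A) (hB : Differentiable ℂ B) (hC : Differentiable ℂ C)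
    (h1 : ∀ z ∈ U, ∀ j : ℕ, j < n → 0 < (A z + j * C z).re)
    (h2 : ∀ z ∈ U, ∀ j : ℕ, j < n → 0 < (B z + j * C z).re)
    (h3 : ∀ z ∈ U, ∀ j : ℕ, j < n → 0 < (1 + (j + 1) * C z).re)
    (h4 : ∀ z ∈ U, ∀ j : ℕ, j < n → 0 < (A z + B z + ((n : ℂ) + j - 1) * C z).re)
    (h5 : ∀ z ∈ U, 0 < (1 + C z).re) :
    DifferentiableOn ℂ (fun z => selbergProductC n (A z) (B z) (C z)) U := by
  unfold selbergProductC
  refine DifferentiableOn.fun_finsetProd fun j hj => ?_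
  rw [Finset.mem_range] at hj
  refine DifferentiableOn.div (DifferentiableOn.mul (DifferentiableOn.mul ?_ ?_) ?_)
    (DifferentiableOn.mul ?_ ?_) ?_
  · exact differentiableOn_Gamma_comp (by fun_prop) fun z hz => h1 z hz j hj
  · exact differentiableOn_Gamma_comp (by fun_prop) fun z hz => h2 z hz j hj
  · exact differentiableOn_Gamma_comp (by fun_prop) fun z hz => h3 z hz j hj
  · exact differentiableOn_Gamma_comp (by fun_prop) fun z hz => h4 z hz j hj
  · exact differentiableOn_Gamma_comp (by fun_prop) fun z hz => h5 z hz
  · intro z hz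
    exact mul_ne_zero (Complex.Gamma_ne_zero_of_re_pos (h4 z hz j hj))
      (Complex.Gamma_ne_zero_of_re_pos (h5 z hz))

/-! ### Strict positivity of the Selberg integral -/

/-- **The Selberg integral is positive** whenever the weight is integrable on the cube.
[folklore] -/
theorem selbergIntegral_pos {n : ℕ} {a b c : ℝ}
    (hint : IntegrableOn (weight n a b c) (cube n)) : 0 < selbergIntegral n a b c := by
  rw [selbergIntegral_eq_integral_weight,
    setIntegral_pos_iff_support_of_nonneg_ae
      (ae_restrict_of_forall_mem (measurableSet_cube n) fun t ht => weight_nonneg a b c ht) hint]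
  -- the open cube with distinct coordinates has measure `1` and lies in the support
  set U : Set (Fin n → ℝ) := (Set.pi Set.univ fun _ => Set.Ioo (0 : ℝ) 1) ∩
    {t | Function.Injective t} with hU
  have hUsub : U ⊆ Function.support (weight n a b c) ∩ cube n := by
    intro t ht
    simp only [hU, Set.mem_inter_iff, Set.mem_univ_pi, Set.mem_Ioo, Set.mem_setOf_eq] at ht
    constructor
    · rw [Function.mem_support]
      refine (mul_pos (prod_pos fun i _ => mul_pos (rpow_pos_of_pos (ht.1 i).1 _)
        (rpow_pos_of_pos (by linarith [(ht.1 i).2]) _)) (prod_pos fun i _ =>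
          prod_pos fun j hj => rpow_pos_of_pos (abs_pos.2 (sub_ne_zero.2 fun h => ?_)) _)).ne'
      rw [Finset.mem_filter] at hj
      exact (ne_of_lt hj.2) (ht.2 h)
    · rw [mem_cube_iff]
      exact fun i => ⟨(ht.1 i).1.le, (ht.1 i).2.le⟩
  have hUvol : volume U = 1 := by
    rw [hU, measure_inter_conull, volume_pi_pi]
    · simp
    · show volume {t : Fin n → ℝ | ¬Function.Injective t} = 0
      exact ae_iff.1 (ae_injective n)
  calc (0 : ℝ≥0∞) < 1 := zero_lt_one
    _ = volume U := hUvol.symm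
    _ ≤ volume (Function.support (weight n a b c) ∩ cube n) := measure_mono hUsub

/-- The Selberg integral is positive for `a, b > 0`, `c ≥ 0`. [folklore] -/
theorem selbergIntegral_pos_of_nonneg {n : ℕ} {a b c : ℝ} (ha : 0 < a) (hb : 0 < b) (hc : 0 ≤ c) :
    0 < selbergIntegral n a b c :=
  selbergIntegral_pos (integrableOn_weight ha hb hc)

/-! ### Log-convexity in `a` -/

/-- **`a ↦ log Sₙ(a, b, c)` is convex on `(0, ∞)`** for `b > 0`, `c ≥ 0` (Hölder). [folklore] -/
theorem convexOn_log_selbergIntegral (n : ℕ) {b c : ℝ} (hb : 0 < b) (hc : 0 ≤ c) :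
    ConvexOn ℝ (Set.Ioi 0) (fun a => Real.log (selbergIntegral n a b c)) := by
  refine convexOn_iff_forall_pos.mpr ⟨convex_Ioi 0, fun x hx y hy θ η hθ hη hθη => ?_⟩
  simp only [smul_eq_mul]
  rw [Set.mem_Ioi] at hx hy
  have hxy : 0 < θ * x + η * y := by positivity
  have hSx := selbergIntegral_pos_of_nonneg (n := n) hx hb hc
  have hSy := selbergIntegral_pos_of_nonneg (n := n) hy hb hc
  have hS := selbergIntegral_pos_of_nonneg (n := n) hxy hb hc
  rw [← log_rpow hSx, ← log_rpow hSy, ← log_mul (rpow_pos_of_pos hSx θ).ne'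
    (rpow_pos_of_pos hSy η).ne']
  refine Real.log_le_log hS ?_
  have hθη' : η = 1 - θ := by linarith
  have key := mgf_mul_add_mul_le_rpow (μ := cubeMeasure n (densA n b c)) (X := XA n)
    (measurable_XA n).aemeasurable (s := x - 1) (t := y - 1) (a := θ) (b := η)
    ((integrable_exp_XA_iff b c (x - 1)).2 (by
      rw [sub_add_cancel]; exact integrableOn_weight hx hb hc))
    ((integrable_exp_XA_iff b c (y - 1)).2 (by
      rw [sub_add_cancel]; exact integrableOn_weight hy hb hc)) hθ hη hθη
  rw [selbergIntegral_eq_mgf_A, selbergIntegral_eq_mgf_A, selbergIntegral_eq_mgf_A]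
  convert key using 2
  rw [hθη']
  ring

/-- `Γ(x)/Γ(x + d) = S₁(x, d, 0)/Γ(d)` for `x, d > 0` (Euler's Beta integral). [folklore] -/
theorem Gamma_div_Gamma_add_eq {x d : ℝ} (hx : 0 < x) (hd : 0 < d) :
    Gamma x / Gamma (x + d) = selbergIntegral 1 x d 0 / Gamma d := by
  rw [selbergIntegral_one_eq 0 hx hd]
  have hΓd := (Gamma_pos_of_pos hd).ne'
  have hΓxd := (Gamma_pos_of_pos (add_pos hx hd)).ne'
  field_simp

/-- **`a ↦ log selbergProduct (m+1) a b c` is convex on `(0, ∞)`** for `b > 0`, `c ≥ 0`: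
each factor `Γ(a+jc)/Γ(a+jc+d)`, `d = b + mc`, is a Beta integral in `a + jc`. [folklore] -/
theorem convexOn_log_selbergProduct (m : ℕ) {b c : ℝ} (hb : 0 < b) (hc : 0 ≤ c) :
    ConvexOn ℝ (Set.Ioi 0) (fun a => Real.log (selbergProduct (m + 1) a b c)) := by
  set d : ℝ := b + m * c with hd
  have hdpos : 0 < d := by positivity
  -- the `j`-th summand of `log selbergProduct` as a function of `a`
  set ψ : ℕ → ℝ → ℝ := fun j a => Real.log (selbergIntegral 1 (a + j * c) d 0) with hψ
  set κ : ℕ → ℝ := fun j => -Real.log (Gamma d) + Real.log (Gamma (b + j * c)) +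
    Real.log (Gamma (1 + (j + 1) * c)) - Real.log (Gamma (1 + c)) with hκ
  have hdecomp : ∀ a, 0 < a → Real.log (selbergProduct (m + 1) a b c) =
      ∑ j ∈ range (m + 1), (ψ j a + κ j) := by
    intro a ha
    rw [selbergProduct, Real.log_prod]
    · refine Finset.sum_congr rfl fun j hj => ?_
      have haj : 0 < a + j * c := by positivity
      have hbj : 0 < b + j * c := by positivity
      have h1c : 0 < 1 + ((j : ℝ) + 1) * c := by positivity
      have h1c' : 0 < 1 + c := by positivity
      have hsum : a + b + (((m + 1 : ℕ) : ℝ) + j - 1) * c = (a + j * c) + d := by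
        simp only [hd]; push_cast; ring
      rw [hsum]
      have hS1 : Real.log (selbergIntegral 1 (a + j * c) d 0) = Real.log (Gamma (a + j * c)) +
          Real.log (Gamma d) - Real.log (Gamma (a + j * c + d)) := by
        rw [selbergIntegral_one_eq 0 haj hdpos, Real.log_div (by positivity) (by positivity),
          Real.log_mul (by positivity) (by positivity)]
      simp only [hψ, hκ]
      rw [Real.log_div (by positivity) (by positivity), Real.log_mul (by positivity) (by positivity),
        Real.log_mul (by positivity) (by positivity), Real.log_mul (by positivity) (by positivity),
        hS1]
      ring
    · intro j hj
      have hsum : a + b + (((m + 1 : ℕ) : ℝ) + j - 1) * c = (a + j * c) + d := by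
        simp only [hd]; push_cast; ring
      rw [hsum]
      positivity
  -- convexity of each `ψ j` on `(0, ∞)`
  have hconv1 := convexOn_log_selbergIntegral 1 hdpos le_rfl
  have hψconv : ∀ j : ℕ, ConvexOn ℝ (Set.Ioi 0) (ψ j) := by
    intro j
    have h := hconv1.translate_right ((j : ℝ) * c)
    refine (h.subset (fun a ha => ?_) (convex_Ioi 0)).congr ?_
    · simp only [Set.mem_preimage, Set.mem_Ioi] at ha ⊢
      have : 0 ≤ (j : ℝ) * c := by positivity
      linarith
    · intro a _
      simp only [hψ, Function.comp_apply]
      rw [add_comm]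
  -- assemble
  refine ⟨convex_Ioi 0, fun x hx y hy θ η hθ hη hθη => ?_⟩
  simp only [smul_eq_mul]
  rw [Set.mem_Ioi] at hx hy
  have hxy : 0 < θ * x + η * y := by
    rcases hθ.lt_or_eq with hθ' | hθ'
    · positivity
    · rw [← hθ'] at hθη ⊢
      simp only [zero_add] at hθη
      rw [hθη]
      simpa using hy
  rw [hdecomp _ hxy, hdecomp _ hx, hdecomp _ hy, Finset.mul_sum, Finset.mul_sum,
    ← Finset.sum_add_distrib]
  refine Finset.sum_le_sum fun j _ => ?_
  have := (hψconv j).2 (Set.mem_Ioi.2 hx) (Set.mem_Ioi.2 hy) hθ hη hθη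
  simp only [smul_eq_mul] at this
  have hk : θ * κ j + η * κ j = κ j := by rw [← add_mul, hθη, one_mul]
  rw [mul_add, mul_add]
  linarith [this, hk]

end Selberg

end Literature.Analysis.SpecialFunctions

end
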